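import Mathlib

/-!
# Two-term block law — the tensor octagon bound (cell pub-hsemireg · 18881 · embed g10)

Companion kernel file of the memo `TWO-TERM-BLOCK-LAW-embed-g10.md` (same directory).
HONESTY CLAUSE: nothing here is proved toward HC ∕ HC_CM ∕ HC_AV ∕ №4 ∕ 26512 ∕ 18881 ∕ H2, and nothing is a rung of
`stub_rung_pad4_seedAt`; this is EVIDENCE (pure linear algebra over `ℂ`), Mathlib-only, no `sorry`, no new axioms.

## What is certified (pure algebra; the sheaf-level reading is PEN, in the memo)

Index a `2^F × 2^F` complex matrix written in the product basis of `(ℂ²)^{⊗F}` by `st : Fin F → Bool × Bool`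
(per factor: row bit, column bit).  For weights `w j : ℝ` and vectors `v j f : ℂ × ℂ` the ORDER-`F` MOMENT TENSOR
`momentTensor w v = Σ_j w_j ⊗_f |v_{j f}⟩⟨v_{j f}|` has entries
`Σ_j w_j Π_f (v_{j f})_{s_f} · conj (v_{j f})_{t_f}`; the WEIL TARGET of charge `μ` is
`weilTarget F μ = μ |0…0⟩⟨1…1| + conj μ |1…1⟩⟨0…0|`.

* `weilCharge_eq_zero_of_card_lt_two_mul` (TENSOR `2F`-GON BOUND): if `momentTensor w v = weilTarget F μ` and the number of
  terms is `< 2F`, then `μ = 0`.  (Sharp: the regular `2F`-gon on a latitude circle, taken diagonally with alternating signs,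
  realises `μ ≠ 0` with exactly `2F` terms — pen, memo §3; for `F = 4` this is the OCTAGON of `OCTAGON-ONSET-THEOREM-embed-g9.md`.)
* `weilCharge_eq_zero_of_card_lt_eight` : the case `F = 4` — fewer than EIGHT distinct ray-tuples never carry a non-zero Weil
  charge at order 4, whatever the signs, scales, frames or latitudes.
* `blockLaw_charge_zero_of_rank_le_seven` : the same statement read with `ι` = the live ray-tuple blocks of a two-term room
  (`card ι ≤ rank 𝓔 ≤ 7`), i.e. the algebraic half of the TWO-TERM BLOCK LAW of the memo (§2): on a hub-free one-apex LINE
  alphabet of ANY CM frame, a torsion-free two-term presentation of rank `≤ 7` with `(H1)`-clean class has Weil charge `0`.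
* `octagon_sharp` : SHARPNESS AT `F = 4` — the Gaussian octagon `{i^m (−2 ± i)}` taken diagonally with alternating weights
  `±1` is clean with charge `192 i ≠ 0` (`octagon_charge_ne_zero`), so EIGHT is the exact threshold of the block law;
  `digon_sharp` : sharpness at `F = 1` (`|+⟩⟨+| − |−⟩⟨−|` has charge `2` with `2 = 2F` terms); `pairing_identity`,
  `charge_zero_of_two_annihilators`, `kill_one`, `kill_two` are the four steps of the proof of the bound.

Dictionary (memo §1, from `CELESTIAL-PHASE-LAW-embed-g6.md` §1 (M′)): a null forward co-letter `y = (c; d; β)` of factor `f`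
(`c² = D d² + |β|²_δ`) is the rank-one PSD matrix `Y = [[c + d′, β′], [conj β′, c − d′]] = |v⟩⟨v|` (`d′ = √D d`,
`β′ = G + i√δ B`); `e^{-nh}·ch(L_x) = Π_f (1 − y_f)` makes the degree-8 part of `ch` of a design the tensor
`Σ_cells ν(x) ⊗_f Y_f(x)`, cells on one ray-tuple giving proportional product projectors, and order-4 `(H1)`-cleanness says
exactly `Σ ⊗ Y = weilTarget 4 μ`.  The proof is the «two annihilators per factor» argument of memo §3: a Hermitian `2 × 2`
functional with non-zero off-diagonal entry kills any two prescribed rank-one projectors (`kill_two`), one with PRESCRIBED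
off-diagonal entry kills any one (`kill_one`); contracting every factor kills all `< 2F` terms while the target contracts to
`μ Z + conj (μ Z)` with `Z = ζ · Z₀`, `Z₀ ≠ 0`, `ζ ∈ {1, i}` free — whence `μ = 0`.

Sources: cell memos CELESTIAL-PHASE-LAW-embed-g6 (model), OCTAGON-ONSET-THEOREM-embed-g9 (octagon, diagonal LP),
C4-SLOPE-DISCIPLINE-c4-1-g4 (THEOREM BD(c): square block ⇒ torsion cokernel), C4-LIFT-LAWS-c4-1-g5 §1 (g0 THEOREM C: forced
splitting along live components; ROW CC block budget); [BF03] Buchweitz–Flenner, semiregularity (ch-additivity on blocks);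
Mumford, Abelian Varieties §16 (vanishing of `H⁰` of non-effective classes).
-/

set_option linter.dupNamespace false

open scoped BigOperators ComplexConjugate

namespace Summit.HodgeConjecture.HodgeConjecture.Cruxes.BlochSeedDiscOne.TwoTermBlockLaw

open Complex Finset

/-! ## The model: product-basis entries of weighted sums of product projectors -/

/-- Index of an entry of a `2^F × 2^F` matrix in the product basis: per factor (row bit, column bit). -/
abbrev Idx (F : ℕ) := Fin F → Bool × Bool

/-- Component `b` of a vector of `ℂ²` (`false ↦` first, `true ↦` second coordinate). -/
def comp (p : ℂ × ℂ) (b : Bool) : ℂ := bif b then p.2 else p.1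

@[simp] theorem comp_false (p : ℂ × ℂ) : comp p false = p.1 := rfl
@[simp] theorem comp_true (p : ℂ × ℂ) : comp p true = p.2 := rfl

/-- Entry `st` of the product projector `⊗_f |v_f⟩⟨v_f|`. -/
def projEntry {F : ℕ} (v : Fin F → ℂ × ℂ) (st : Idx F) : ℂ :=
  ∏ f, comp (v f) (st f).1 * conj (comp (v f) (st f).2)

/-- The order-`F` moment tensor `Σ_j w_j ⊗_f |v_{j f}⟩⟨v_{j f}|` of finitely many weighted product projectors
(real weights of either sign; vectors of any length, zero allowed). -/
def momentTensor {F : ℕ} {ι : Type*} [Fintype ι] (w : ι → ℝ) (v : ι → Fin F → ℂ × ℂ) (st : Idx F) : ℂ :=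
  ∑ j, (w j : ℂ) * projEntry (v j) st

/-- The Weil target `μ |0…0⟩⟨1…1| + conj μ |1…1⟩⟨0…0|` (order-`F` part of `μ e^{⊗F} + conj μ ē^{⊗F}`). -/
def weilTarget (F : ℕ) (μ : ℂ) (st : Idx F) : ℂ :=
  (if st = (fun _ => (false, true)) then μ else 0) + (if st = (fun _ => (true, false)) then conj μ else 0)

/-- Order-`F` cleanness with Weil charge `μ`: the moment tensor IS the Weil target (all other entries vanish). -/
def CleanWithCharge {F : ℕ} {ι : Type*} [Fintype ι] (w : ι → ℝ) (v : ι → Fin F → ℂ × ℂ) (μ : ℂ) : Prop :=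
  ∀ st, momentTensor w v st = weilTarget F μ st

/-! ## Contraction by one `2 × 2` functional per factor -/

/-- The quadratic form `⟨v|L|v⟩ = Σ_{a,b} conj (v_b) · L_{b a} · v_a` of a `2 × 2` matrix `L` (indexed `L row col`). -/
def qform (L : Bool → Bool → ℂ) (p : ℂ × ℂ) : ℂ :=
  ∑ ab : Bool × Bool, L ab.2 ab.1 * (comp p ab.1 * conj (comp p ab.2))

/-- The contraction weight `Π_f Λ_f[t_f][s_f]` of the functional `X ↦ Π_f tr(Λ_f X_f)` at the entry `st`. -/
def cwt {F : ℕ} (Λ : Fin F → Bool → Bool → ℂ) (st : Idx F) : ℂ := ∏ f, Λ f (st f).2 (st f).1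

/-- `2 × 2` Hermitian. -/
def IsHerm (L : Bool → Bool → ℂ) : Prop := ∀ a b, L a b = conj (L b a)

theorem qform_eq (L : Bool → Bool → ℂ) (p : ℂ × ℂ) :
    qform L p = L false false * (p.1 * conj p.1) + L true true * (p.2 * conj p.2)
      + L true false * (p.1 * conj p.2) + L false true * (p.2 * conj p.1) := by
  simp only [qform, Fintype.sum_prod_type, Fintype.sum_bool, comp_true, comp_false]
  ring

/-- Contracting a product projector factor by factor gives the product of the quadratic forms. -/
theorem sum_cwt_mul_projEntry {F : ℕ} (Λ : Fin F → Bool → Bool → ℂ) (v : Fin F → ℂ × ℂ) :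
    ∑ st, cwt Λ st * projEntry v st = ∏ f, qform (Λ f) (v f) := by
  have h1 : ∀ st : Idx F, cwt Λ st * projEntry v st
      = ∏ f, (Λ f (st f).2 (st f).1 * (comp (v f) (st f).1 * conj (comp (v f) (st f).2))) := by
    intro st
    rw [cwt, projEntry, ← Finset.prod_mul_distrib]
  simp_rw [h1]
  rw [show (∑ st : Idx F, ∏ f, (Λ f (st f).2 (st f).1 * (comp (v f) (st f).1 * conj (comp (v f) (st f).2))))
      = ∏ f, ∑ ab : Bool × Bool, (Λ f ab.2 ab.1 * (comp (v f) ab.1 * conj (comp (v f) ab.2))) from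
    (Fintype.prod_sum (fun f (ab : Bool × Bool) => Λ f ab.2 ab.1 * (comp (v f) ab.1 * conj (comp (v f) ab.2)))).symm]
  rfl

/-- Contracting the Weil target: only the two corner entries survive. -/
theorem sum_cwt_mul_weilTarget {F : ℕ} (Λ : Fin F → Bool → Bool → ℂ) (μ : ℂ) :
    ∑ st, cwt Λ st * weilTarget F μ st
      = μ * ∏ f, Λ f true false + conj μ * ∏ f, Λ f false true := by
  simp only [weilTarget, mul_add, Finset.sum_add_distrib, mul_ite, mul_zero, Finset.sum_ite_eq', Finset.mem_univ,
    if_true]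
  simp only [cwt]
  ring

/-- THE PAIRING IDENTITY.  Contracting a clean configuration with Hermitian functionals `Λ_f`:
`Σ_j w_j Π_f ⟨v_{jf}|Λ_f|v_{jf}⟩ = μ Z + conj (μ Z)`, `Z = Π_f (Λ_f)₁₀`. -/
theorem pairing_identity {F : ℕ} {ι : Type*} [Fintype ι] {w : ι → ℝ} {v : ι → Fin F → ℂ × ℂ} {μ : ℂ}
    (h : CleanWithCharge w v μ) (Λ : Fin F → Bool → Bool → ℂ) (hΛ : ∀ f, IsHerm (Λ f)) :
    ∑ j, (w j : ℂ) * ∏ f, qform (Λ f) (v j f)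
      = μ * ∏ f, Λ f true false + conj (μ * ∏ f, Λ f true false) := by
  have key : ∑ st, cwt Λ st * momentTensor w v st = ∑ st, cwt Λ st * weilTarget F μ st :=
    Finset.sum_congr rfl fun st _ => by rw [h st]
  rw [sum_cwt_mul_weilTarget] at key
  have lhs : ∑ st, cwt Λ st * momentTensor w v st = ∑ j, (w j : ℂ) * ∏ f, qform (Λ f) (v j f) := by
    simp only [momentTensor, Finset.mul_sum]
    rw [Finset.sum_comm]
    refine Finset.sum_congr rfl fun j _ => ?_
    rw [← sum_cwt_mul_projEntry, Finset.mul_sum]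
    refine Finset.sum_congr rfl fun st _ => ?_
    ring
  rw [← lhs, key, map_mul, map_prod]
  congr 2
  exact Finset.prod_congr rfl fun f _ => hΛ f false true

/-- From two annihilating Hermitian families whose off-diagonal products differ by the phase `i`, the charge vanishes. -/
theorem charge_zero_of_two_annihilators {F : ℕ} {ι : Type*} [Fintype ι] {w : ι → ℝ} {v : ι → Fin F → ℂ × ℂ} {μ : ℂ}
    (h : CleanWithCharge w v μ) (Λ₁ Λ₂ : Fin F → Bool → Bool → ℂ) (h₁ : ∀ f, IsHerm (Λ₁ f)) (h₂ : ∀ f, IsHerm (Λ₂ f))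
    (k₁ : ∀ j, ∃ f, qform (Λ₁ f) (v j f) = 0) (k₂ : ∀ j, ∃ f, qform (Λ₂ f) (v j f) = 0)
    (hZ : ∏ f, Λ₁ f true false ≠ 0) (hphase : ∏ f, Λ₂ f true false = I * ∏ f, Λ₁ f true false) : μ = 0 := by
  have e₁ := pairing_identity h Λ₁ h₁
  have e₂ := pairing_identity h Λ₂ h₂
  have z₁ : ∑ j, (w j : ℂ) * ∏ f, qform (Λ₁ f) (v j f) = 0 :=
    Finset.sum_eq_zero fun j _ => by
      obtain ⟨f, hf⟩ := k₁ j
      rw [Finset.prod_eq_zero (Finset.mem_univ f) hf, mul_zero]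
  have z₂ : ∑ j, (w j : ℂ) * ∏ f, qform (Λ₂ f) (v j f) = 0 :=
    Finset.sum_eq_zero fun j _ => by
      obtain ⟨f, hf⟩ := k₂ j
      rw [Finset.prod_eq_zero (Finset.mem_univ f) hf, mul_zero]
  rw [z₁] at e₁
  rw [z₂, hphase] at e₂
  set u : ℂ := μ * ∏ f, Λ₁ f true false with hu
  have hre : u.re = 0 := by
    have := congrArg Complex.re e₁
    simp only [Complex.zero_re, Complex.add_re, Complex.conj_re] at this
    linarith
  have him : u.im = 0 := by
    have e₂' : (0 : ℂ) = I * u + conj (I * u) := by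
      have hIu : μ * (I * ∏ f, Λ₁ f true false) = I * u := by rw [hu]; ring
      rwa [hIu] at e₂
    have := congrArg Complex.re e₂'
    simp only [Complex.zero_re, Complex.add_re, Complex.conj_re, Complex.I_mul_re] at this
    linarith
  have hu0 : u = 0 := by apply Complex.ext <;> simp [hre, him]
  rcases mul_eq_zero.mp hu0 with hμ | hZ'
  · exact hμ
  · exact absurd hZ' hZ

/-! ## The two annihilator lemmas (`2 × 2` linear algebra) -/

/-- The Hermitian matrix `[[P, conj z], [z, Q]]` (`L true false = z`). -/
def herm (P Q : ℝ) (z : ℂ) : Bool → Bool → ℂ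
  | false, false => P
  | false, true => conj z
  | true, false => z
  | true, true => Q

theorem isHerm_herm (P Q : ℝ) (z : ℂ) : IsHerm (herm P Q z) := by
  intro a b
  cases a <;> cases b <;> simp [herm, Complex.conj_ofReal]

@[simp] theorem herm_true_false (P Q : ℝ) (z : ℂ) : herm P Q z true false = z := rfl

theorem qform_herm (P Q : ℝ) (z : ℂ) (p : ℂ × ℂ) :
    qform (herm P Q z) p
      = ((P * normSq p.1 + Q * normSq p.2 + 2 * (z * (p.1 * conj p.2)).re : ℝ) : ℂ) := by
  rw [qform_eq]
  have hc : conj z * (p.2 * conj p.1) = conj (z * (p.1 * conj p.2)) := by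
    simp only [map_mul, Complex.conj_conj]; ring
  simp only [herm]
  rw [hc, Complex.mul_conj, Complex.mul_conj, add_assoc, Complex.add_conj]
  push_cast
  ring

theorem I_mul_conj_mul_re (a b : ℂ) : (I * conj a * b).re = -(a.re * b.im - a.im * b.re) := by
  simp only [Complex.mul_re, Complex.mul_im, Complex.I_re, Complex.I_im, Complex.conj_re, Complex.conj_im]
  ring

/-- KILL ONE WITH PRESCRIBED OFF-DIAGONAL: for every `v ∈ ℂ²` and `z ∈ ℂ` there is a Hermitian `Λ` with `Λ₁₀ = z` and
`⟨v|Λ|v⟩ = 0`. -/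
theorem kill_one (p : ℂ × ℂ) (z : ℂ) :
    ∃ L : Bool → Bool → ℂ, IsHerm L ∧ L true false = z ∧ qform L p = 0 := by
  set n : ℝ := normSq p.1 + normSq p.2 with hn
  set r : ℝ := (z * (p.1 * conj p.2)).re with hr
  refine ⟨herm (-(2 * r) / n) (-(2 * r) / n) z, isHerm_herm _ _ _, rfl, ?_⟩
  rw [qform_herm, Complex.ofReal_eq_zero, ← hr]
  by_cases h0 : n = 0
  · have h1 : normSq p.1 = 0 := by
      have := normSq_nonneg p.1; have := normSq_nonneg p.2; linarith
    have hp1 : p.1 = 0 := normSq_eq_zero.mp h1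
    have hr0 : r = 0 := by rw [hr, hp1]; simp
    rw [hr0, h1]
    have h2 : normSq p.2 = 0 := by
      have := normSq_nonneg p.1; have := normSq_nonneg p.2; linarith
    rw [h2]; ring
  · have : -(2 * r) / n * normSq p.1 + -(2 * r) / n * normSq p.2 = -(2 * r) / n * n := by rw [hn]; ring
    rw [this, div_mul_cancel₀ _ h0]; ring

/-- KILL TWO: for every `v₁, v₂ ∈ ℂ²` there is a Hermitian `Λ` with `Λ₁₀ ≠ 0` and `⟨v₁|Λ|v₁⟩ = ⟨v₂|Λ|v₂⟩ = 0`
(two real-linear conditions on the 4-dimensional real space of Hermitian matrices never force `Λ` to be diagonal). -/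
theorem kill_two (p q : ℂ × ℂ) :
    ∃ L : Bool → Bool → ℂ, IsHerm L ∧ L true false ≠ 0 ∧ qform L p = 0 ∧ qform L q = 0 := by
  set C₁ : ℂ := p.1 * conj p.2 with hC₁
  set C₂ : ℂ := q.1 * conj q.2 with hC₂
  set A₁ : ℝ := normSq p.1 with hA₁
  set A₂ : ℝ := normSq q.1 with hA₂
  set D : ℝ := C₁.re * C₂.im - C₁.im * C₂.re with hD
  by_cases hD0 : D = 0
  · -- degenerate case: `P = Q = 0`, `z ⟂ C₁, C₂`
    by_cases h1 : C₁ = 0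
    · by_cases h2 : C₂ = 0
      · refine ⟨herm 0 0 1, isHerm_herm _ _ _, by simp [herm], ?_, ?_⟩
        · rw [qform_herm, Complex.ofReal_eq_zero, ← hC₁, h1]; simp
        · rw [qform_herm, Complex.ofReal_eq_zero, ← hC₂, h2]; simp
      · refine ⟨herm 0 0 (I * conj C₂), isHerm_herm _ _ _, ?_, ?_, ?_⟩
        · rw [herm_true_false]
          exact mul_ne_zero Complex.I_ne_zero ((map_ne_zero_iff _ (RingHom.injective _)).mpr h2)
        · rw [qform_herm, Complex.ofReal_eq_zero, ← hC₁, h1]; simp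
        · rw [qform_herm, Complex.ofReal_eq_zero, ← hC₂, I_mul_conj_mul_re]; ring
    · refine ⟨herm 0 0 (I * conj C₁), isHerm_herm _ _ _, ?_, ?_, ?_⟩
      · rw [herm_true_false]
        exact mul_ne_zero Complex.I_ne_zero ((map_ne_zero_iff _ (RingHom.injective _)).mpr h1)
      · rw [qform_herm, Complex.ofReal_eq_zero, ← hC₁, I_mul_conj_mul_re]; ring
      · rw [qform_herm, Complex.ofReal_eq_zero, ← hC₂, I_mul_conj_mul_re, ← hD, hD0]; ring
  · -- generic case: `P = 1`, `Q = 0`, `z` solves `Re(z Cᵢ) = -Aᵢ/2`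
    set x : ℝ := (A₂ * C₁.im - A₁ * C₂.im) / (2 * D) with hx
    set y : ℝ := (C₁.re * A₂ - C₂.re * A₁) / (2 * D) with hy
    set z : ℂ := ⟨x, y⟩ with hz
    have h2D : (2 : ℝ) * D ≠ 0 := mul_ne_zero two_ne_zero hD0
    have hz1 : (z * C₁).re = -A₁ / 2 := by
      rw [Complex.mul_re]
      show x * C₁.re - y * C₁.im = -A₁ / 2
      rw [hx, hy, div_mul_eq_mul_div, div_mul_eq_mul_div, ← sub_div, div_eq_iff h2D, hD]
      ring
    have hz2 : (z * C₂).re = -A₂ / 2 := by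
      rw [Complex.mul_re]
      show x * C₂.re - y * C₂.im = -A₂ / 2
      rw [hx, hy, div_mul_eq_mul_div, div_mul_eq_mul_div, ← sub_div, div_eq_iff h2D, hD]
      ring
    refine ⟨herm 1 0 z, isHerm_herm _ _ _, ?_, ?_, ?_⟩
    · rw [herm_true_false]
      intro hz0
      have hA1 : A₁ = 0 := by have := hz1; rw [hz0, zero_mul, Complex.zero_re] at this; linarith
      have hp1 : p.1 = 0 := normSq_eq_zero.mp (by rw [← hA₁]; exact hA1)
      have hC10 : C₁ = 0 := by rw [hC₁, hp1, zero_mul]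
      apply hD0
      rw [hD, hC10]; simp
    · rw [qform_herm, Complex.ofReal_eq_zero, ← hC₁, hz1, ← hA₁]; ring
    · rw [qform_herm, Complex.ofReal_eq_zero, ← hC₂, hz2, ← hA₂]; ring

/-! ## The tensor `2F`-gon bound -/

/-- **TENSOR `2F`-GON BOUND.**  If fewer than `2F` weighted product projectors on `(ℂ²)^{⊗F}` (real weights of any sign,
arbitrary vectors) sum to the Weil target `μ |0…0⟩⟨1…1| + conj μ |1…1⟩⟨0…0|`, then `μ = 0`.  Sharp (pen, memo §3): the
regular `2F`-gon on one latitude circle with alternating signs attains `2F`. -/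
theorem weilCharge_eq_zero_of_card_lt_two_mul {F : ℕ} {ι : Type*} [Fintype ι] (w : ι → ℝ)
    (v : ι → Fin F → ℂ × ℂ) (μ : ℂ) (h : CleanWithCharge w v μ) (hcard : Fintype.card ι < 2 * F) : μ = 0 := by
  classical
  have hF : 0 < F := by omega
  set last : Fin F := ⟨F - 1, by omega⟩ with hlast
  -- an injection of the terms into the `2F - 1` slots `(Fin F × Bool) ∖ {(last, true)}`
  obtain ⟨e, he⟩ : ∃ e : ι ↪ Fin F × Bool, Set.range e ⊆ ((Finset.univ.erase (last, true) : Finset (Fin F × Bool)) : Set _) := by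
    apply Function.Embedding.exists_of_card_le_finset
    rw [Finset.card_erase_of_mem (Finset.mem_univ _), Finset.card_univ, Fintype.card_prod, Fintype.card_fin,
      Fintype.card_bool]
    omega
  have he' : ∀ j, e j ≠ (last, true) := fun j => by
    have hm : e j ∈ (Finset.univ.erase (last, true) : Finset (Fin F × Bool)) := Finset.mem_coe.mp (he ⟨j, rfl⟩)
    exact (Finset.mem_erase.mp hm).1
  -- the vector occupying slot `x` in factor `f` (zero if the slot is empty)
  let pre : Fin F × Bool → Fin F → ℂ × ℂ := fun x => if hx : ∃ j, e j = x then v hx.choose else 0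
  have hpre : ∀ j, pre (e j) = v j := by
    intro j
    have hx : ∃ j', e j' = e j := ⟨j, rfl⟩
    simp only [pre, dif_pos hx]
    exact congrArg v (e.injective hx.choose_spec)
  -- one KILL-TWO functional per factor, and a KILL-ONE functional with free phase in the last factor
  have k2 := fun f : Fin F => kill_two (pre (f, false) f) (pre (f, true) f)
  choose Λ₀ hΛ₀h hΛ₀z hΛ₀p hΛ₀q using k2
  have k1 := fun ζ : ℂ => kill_one (pre (last, false) last) ζ
  choose Λk hΛkh hΛkz hΛkp using k1
  let Λ : ℂ → Fin F → Bool → Bool → ℂ := fun ζ => Function.update Λ₀ last (Λk ζ)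
  have hΛherm : ∀ ζ f, IsHerm (Λ ζ f) := by
    intro ζ f
    by_cases hf : f = last
    · subst hf; simp only [Λ, Function.update_self]; exact hΛkh ζ
    · simp only [Λ, Function.update_of_ne hf]; exact hΛ₀h f
  have hΛprod : ∀ ζ, ∏ f, Λ ζ f true false = ζ * ∏ f ∈ Finset.univ.erase last, Λ₀ f true false := by
    intro ζ
    rw [← Finset.mul_prod_erase Finset.univ (fun f => Λ ζ f true false) (Finset.mem_univ last)]
    congr 1
    · simp only [Λ, Function.update_self]; exact hΛkz ζ
    · refine Finset.prod_congr rfl fun f hf => ?_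
      have hf' : f ≠ last := (Finset.mem_erase.mp hf).1
      simp only [Λ, Function.update_of_ne hf']
  have hZ₀ : ∏ f ∈ Finset.univ.erase last, Λ₀ f true false ≠ 0 :=
    Finset.prod_ne_zero_iff.mpr fun f _ => hΛ₀z f
  have hkill : ∀ ζ j, ∃ f, qform (Λ ζ f) (v j f) = 0 := by
    intro ζ j
    refine ⟨(e j).1, ?_⟩
    have hv : v j = pre (e j) := (hpre j).symm
    by_cases hf : (e j).1 = last
    · -- the term sits in the slot `(last, false)` and is killed by the KILL-ONE functional
      have hb : (e j).2 = false := by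
        rcases hb2 : (e j).2 with _ | _
        · rfl
        · exact absurd (Prod.ext hf hb2) (he' j)
      have hx : e j = (last, false) := Prod.ext hf hb
      rw [hv, hx]
      show qform (Λ ζ last) (pre (last, false) last) = 0
      simp only [Λ, Function.update_self]
      exact hΛkp ζ
    · -- the term sits in a slot `(f, b)`, `f ≠ last`, and is killed by the KILL-TWO functional of factor `f`
      rw [hv]
      simp only [Λ, Function.update_of_ne hf]
      rcases hb2 : (e j).2 with _ | _
      · have hx : e j = ((e j).1, false) := Prod.ext rfl hb2
        rw [hx]; exact hΛ₀p _
      · have hx : e j = ((e j).1, true) := Prod.ext rfl hb2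
        rw [hx]; exact hΛ₀q _
  exact charge_zero_of_two_annihilators h (Λ 1) (Λ I) (hΛherm 1) (hΛherm I) (hkill 1) (hkill I)
    (by rw [hΛprod, one_mul]; exact hZ₀) (by rw [hΛprod, hΛprod, one_mul])

/-! ## `F = 4`: the octagon bound and the algebraic half of the block law -/

/-- **OCTAGON BOUND AT ORDER 4.**  Fewer than EIGHT ray-tuples never carry a non-zero Weil charge with clean order-4
moments — whatever the signs, scales, latitudes or CM frame (the frame only decides WHICH rays are available; cf. the
onset table of `OCTAGON-ONSET-THEOREM-embed-g9.md`, whose octagons show that eight suffice). -/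
theorem weilCharge_eq_zero_of_card_lt_eight {ι : Type*} [Fintype ι] (w : ι → ℝ) (v : ι → Fin 4 → ℂ × ℂ) (μ : ℂ)
    (h : CleanWithCharge w v μ) (hcard : Fintype.card ι < 8) : μ = 0 :=
  weilCharge_eq_zero_of_card_lt_two_mul w v μ h (by omega)

/-- **TWO-TERM BLOCK LAW — the algebraic half (memo §2, steps (3)–(4)).**  Read `ι` as the set of LIVE ray-tuple blocks
of a two-term room on a hub-free one-apex LINE alphabet (pen steps (1)–(2) of the memo: the presentation is block-diagonal
along ray-tuples by `Hom`-vanishing, a block of mass `0` is an isomorphism because `𝓔` is torsion-free, so the live blocks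
number at most `r = rank 𝓔`), `w b ⊗_f |v_{b f}⟩⟨v_{b f}|` as the degree-8 part of `e^{-nh}·(ch N_b − ch P_b)`, and
`CleanWithCharge w v μ` as order-4 `(H1)`-cleanness with Weil charge `μ`.  Conclusion: for `r ≤ 7` the charge is `0`;
in particular NO rank-4 torsion-free two-term room on a hub-free one-apex LINE alphabet of ANY frame carries a hyperbolic
Weil class.  (Nothing here is proved toward 18881: the sheaf-level steps are pen, and a seed needs much more than a class.) -/
theorem blockLaw_charge_zero_of_rank_le_seven {ι : Type*} [Fintype ι] (r : ℕ) (hr : r ≤ 7)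
    (hblocks : Fintype.card ι ≤ r) (w : ι → ℝ) (v : ι → Fin 4 → ℂ × ℂ) (μ : ℂ) (h : CleanWithCharge w v μ) :
    μ = 0 :=
  weilCharge_eq_zero_of_card_lt_eight w v μ h (by omega)

/-- Sharpness of the `2F`-gon bound at `F = 1` (the «digon»): `|+⟩⟨+| − |−⟩⟨−| = [[0, 2], [2, 0]]` is clean with charge
`μ = 2 ≠ 0` using exactly `2 = 2F` terms.  (For `F = 4` the sharp configuration is the alternating regular octagon on a
latitude circle, `Σ_{j<8} (−1)^j |x_j⟩⟨x_j|^{⊗4}`, `x_j = (cos φ, sin φ · e^{2πij/8})` — pen, memo §3; its clean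
realisability by LETTERS is g9's onset theorem.) -/
theorem digon_sharp :
    CleanWithCharge (F := 1) (fun b : Bool => if b then (1 : ℝ) else -1)
      (fun b _ => if b then ((1 : ℂ), (1 : ℂ)) else ((1 : ℂ), (-1 : ℂ))) 2 := by
  intro st
  have hst : st = fun _ => st 0 := funext fun i => by rw [Subsingleton.elim i 0]
  rcases hab : st 0 with ⟨a, b⟩
  rw [hab] at hst
  subst hst
  cases a <;> cases b <;>
    simp [momentTensor, projEntry, weilTarget, funext_iff, map_ofNat] <;> norm_num [map_ofNat]

/-! ## Sharpness at `F = 4`: the Gaussian octagon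

Eight rays suffice: the square `{i^m (−2 + i)}` with weight `+1` and its conjugate square `{i^m (−2 − i)}` with
weight `−1` (eight Gaussian integers on the circle `|z|² = 5`, an octagon of alternating sign), taken diagonally
(`v_{j,f} = (1, z_j)` for all four factors), form a clean configuration with charge `μ = 192 i ≠ 0`.  The entry of
the moment tensor at `st` is the power sum `Σ_j w_j z_j^a conj(z_j)^b` with `a`, `b` the numbers of row ∕ column
bits set, and these vanish for `(a, b) ∉ {(0, 4), (4, 0)}` because power sums over an `i`-orbit vanish unless
`4 ∣ a − b`. -/

/-- The Gaussian octagon: `i^m (-2 + i)` (`j = m < 4`) and `i^m (-2 - i)` (`j = 4 + m`). -/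
def octZ : Fin 8 → ℂ :=
  ![⟨-2, 1⟩, ⟨-1, -2⟩, ⟨2, -1⟩, ⟨1, 2⟩, ⟨-2, -1⟩, ⟨1, -2⟩, ⟨2, 1⟩, ⟨-1, 2⟩]

/-- Alternating weights: `+1` on the first square, `−1` on the conjugate square. -/
def octW : Fin 8 → ℝ := ![1, 1, 1, 1, -1, -1, -1, -1]

/-- The diagonal rays `v_{j,f} = (1, z_j)`. -/
def octV (j : Fin 8) (_f : Fin 4) : ℂ × ℂ := (1, octZ j)

/-- The power sums `S a b = Σ_j w_j z_j^a conj(z_j)^b`. -/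
def octS (a b : ℕ) : ℂ := ∑ j, (octW j : ℂ) * (octZ j ^ a * conj (octZ j) ^ b)

theorem octS_eq (a b : ℕ) (ha : a ≤ 4) (hb : b ≤ 4) :
    octS a b = if a = 0 ∧ b = 4 then 192 * I else if a = 4 ∧ b = 0 then conj (192 * I) else 0 := by
  interval_cases a <;> interval_cases b <;>
    (simp [octS, Fin.sum_univ_eight, octZ, octW, Complex.ext_iff, pow_succ, Complex.mul_re, Complex.mul_im] <;>
      norm_num)

theorem projEntry_const {F : ℕ} (z : ℂ) (st : Idx F) :
    projEntry (fun _ => ((1 : ℂ), z)) st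
      = z ^ (univ.filter fun f => (st f).1 = true).card
        * conj z ^ (univ.filter fun f => (st f).2 = true).card := by
  unfold projEntry
  have h2 : ∀ b : Bool, conj (comp ((1 : ℂ), z) b) = if b = true then conj z else 1 := by
    intro b; cases b <;> simp
  have h1 : ∀ b : Bool, comp ((1 : ℂ), z) b = if b = true then z else 1 := by
    intro b; cases b <;> simp
  simp_rw [h2, h1]
  rw [Finset.prod_mul_distrib, Finset.prod_ite, Finset.prod_const, Finset.prod_const_one, mul_one,
    Finset.prod_ite, Finset.prod_const, Finset.prod_const_one, mul_one]

theorem card_filter_univ_eq_zero_iff {α : Type*} [Fintype α] (p : α → Prop) [DecidablePred p] :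
    (univ.filter p).card = 0 ↔ ∀ x, ¬ p x := by
  simp [Finset.card_eq_zero, Finset.filter_eq_empty_iff]

theorem card_filter_univ_eq_card_iff {α : Type*} [Fintype α] (p : α → Prop) [DecidablePred p] :
    (univ.filter p).card = Fintype.card α ↔ ∀ x, p x := by
  constructor
  · intro h x
    have hsub : univ.filter p = univ :=
      Finset.eq_of_subset_of_card_le (Finset.filter_subset _ _) (by rw [h, Finset.card_univ])
    have hx : x ∈ univ.filter p := by rw [hsub]; exact Finset.mem_univ x
    exact (Finset.mem_filter.mp hx).2
  · intro h
    rw [Finset.filter_true_of_mem (fun x _ => h x), Finset.card_univ]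

theorem card_filter_fin4_eq_four_iff (p : Fin 4 → Prop) [DecidablePred p] :
    (univ.filter p).card = 4 ↔ ∀ x, p x := by
  have h := card_filter_univ_eq_card_iff p
  simp only [Fintype.card_fin] at h
  exact h

theorem const_ft_iff (st : Idx 4) :
    ((∀ f, ¬ (st f).1 = true) ∧ (∀ f, (st f).2 = true)) ↔ st = fun _ => (false, true) := by
  constructor
  · rintro ⟨h1, h2⟩; funext f
    exact Prod.ext (by simpa using h1 f) (h2 f)
  · rintro rfl; simp

theorem const_tf_iff (st : Idx 4) :
    ((∀ f, (st f).1 = true) ∧ (∀ f, ¬ (st f).2 = true)) ↔ st = fun _ => (true, false) := by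
  constructor
  · rintro ⟨h1, h2⟩; funext f
    exact Prod.ext (h1 f) (by simpa using h2 f)
  · rintro rfl; simp

/-- SHARPNESS OF THE OCTAGON BOUND AT `F = 4`: eight diagonal product projectors on the Gaussian octagon, with
alternating weights `±1`, are clean with charge `μ = 192 i ≠ 0`.  Together with
`weilCharge_eq_zero_of_card_lt_eight` this shows that `8` is the exact threshold. -/
theorem octagon_sharp : CleanWithCharge octW octV (192 * I) := by
  intro st
  have hmain : momentTensor octW octV st
      = octS (univ.filter fun f => (st f).1 = true).card (univ.filter fun f => (st f).2 = true).card := by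
    unfold momentTensor octS
    refine Finset.sum_congr rfl fun j _ => ?_
    rw [show octV j = fun _ => ((1 : ℂ), octZ j) from rfl, projEntry_const]
  have ha : (univ.filter fun f => (st f).1 = true).card ≤ 4 :=
    (Finset.card_filter_le _ _).trans_eq (by simp)
  have hb : (univ.filter fun f => (st f).2 = true).card ≤ 4 :=
    (Finset.card_filter_le _ _).trans_eq (by simp)
  rw [hmain, octS_eq _ _ ha hb]
  have e1 : ((univ.filter fun f => (st f).1 = true).card = 0 ∧
      (univ.filter fun f => (st f).2 = true).card = 4) ↔ st = fun _ => (false, true) := by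
    rw [card_filter_univ_eq_zero_iff, card_filter_fin4_eq_four_iff]; exact const_ft_iff st
  have e2 : ((univ.filter fun f => (st f).1 = true).card = 4 ∧
      (univ.filter fun f => (st f).2 = true).card = 0) ↔ st = fun _ => (true, false) := by
    rw [card_filter_fin4_eq_four_iff, card_filter_univ_eq_zero_iff]; exact const_tf_iff st
  unfold weilTarget
  by_cases h1 : st = fun _ => (false, true)
  · have h2 : ¬ st = fun _ => (true, false) := by
      intro h; have := congrFun (h1.symm.trans h) 0; simp at this
    rw [if_pos (e1.mpr h1), if_pos h1, if_neg h2, add_zero]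
  · rw [if_neg (mt e1.mp h1), if_neg h1, zero_add]
    by_cases h2 : st = fun _ => (true, false)
    · rw [if_pos (e2.mpr h2), if_pos h2]
    · rw [if_neg (mt e2.mp h2), if_neg h2]

/-- `192 i ≠ 0`: the octagon configuration carries a genuine charge. -/
theorem octagon_charge_ne_zero : (192 : ℂ) * I ≠ 0 :=
  mul_ne_zero (by norm_num) I_ne_zero

end Summit.HodgeConjecture.HodgeConjecture.Cruxes.BlochSeedDiscOne.TwoTermBlockLaw
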